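import Mathlib
import Summits.KontsevichZagierPeriods.Zeta5Search.CatalanRemarksVTLagrange
import HarnessLib

/-!
# Catalan box family — Zudilin's second construction (12)–(13): `B̃_n = 0` and `ṽ_n` as a residue sum

HONEST FRAMING: systematic search; no irrationality claim unless certified.  Exact identities between explicitly defined
rational numbers; nothing in this file is a statement about Catalan's constant.

Cell `pub-zeta5`, planner seat `fam-catalan` (gen 8), kernel target K-vT-odd, file 3 of 5 [Zudilin2002CatalanRemarks,
Theorem 2].  File 1 (`CatalanRemarksVTResidues`) proved `A(n)Ṽ_{n+1} − q̃(n)Ṽ_n − C(n)Ṽ_{n−1} = B̃_n` for the residue sum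
`Ṽ_n = VresT n = −Σ_k resRT n k·κ(k)` with the inhomogeneity `B̃_n = BsumT n = Σ_k telT n k/(1−P_k)²` (`= −S̃_n′(1)` for the
telescoper `S̃_n = σ̃_nR̃_n`).  Here:
* `telT_eq_resRT_mul`, `sigma_decompT` — on the poles of `R̃_n`, `telT = resRT·σ̃_n(P_k)` and the partial fractions
  `σ̃_n(P)/(1−P)² = ẽ₀ + ẽ₁/(1−P) + ẽ₂/(1−P)² + ẽ₃/(4P−2n−3)` with explicit `ẽ_i(n)` (found by exact interpolation, seat
  folder `kV/moments.py`, `gen_b2.py`; the identity is then ONE `ring`);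
* **`BsumT_eq_zero : 2 ≤ n → BsumT n = 0`** — `B̃_n = μ̃_n(ẽ₀M₀ + ẽ₁M₁ + ẽ₂M₂ + ¼ẽ₃·Σ_i lagT·(ν_i−ν_{2n+1})⁻¹) + (the
  `P_{n+1}`-term)`; the three moments vanish (file 2) and the last two terms cancel in closed form.  At `n = 1` the
  statement is false (`B̃_1 = 516`): `R̃_1 = −t(t−1)/((t+¼)(t−¼)(t−¾))` has only a SIMPLE zero at `t = 1`, which is why
  the identification below patches the value at `n = 0` (`ṽ_0 = −1` while `Ṽ_0 = 0`);
* `VresT_one = 5 = ṽ_1`, `VresT_two = 1897/36 = ṽ_2`, and **`vT_eq_VresT : 1 ≤ n → Zudilin2003.vT n = VresT n`** (the patched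
  sequence `VseqT` solves (13): at `n = 1` by the three values, from `n = 2` on by `VresT_rec` + `BsumT_eq_zero`;
  uniqueness `IsSolutionT.ext_of_init`).
This is the representation of `ṽ_n` behind "(14) by word-by-word repetition of Sect. 1", needed by the denominator file 4.
-/

noncomputable section

namespace Summit.KontsevichZagierPeriods.Zeta5Search.CatalanRemarksVT

open Finset
open Literature.NumberTheory.Irrationality.Zudilin2003
  (pT qT IsSolutionT solT uT vT vT_two solT_isSolutionT)
open Literature.NumberTheory.Irrationality.Zudilin2003.Remarks
  (invFac invFac_natCast invFac_of_neg invFac_eq_succ_mul pole xq node node_eq_pole one_ne_node wsum kap kapPos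
    kapNeg nodalWeight_eq)
open Literature.NumberTheory.Irrationality.KrattenthalerRivoal2008 (gbinom)

/-! ### The partial fractions of `σ̃_n(P)/(1−P)²` -/

/-- `ẽ₀(n)`. [cite: Zudilin2002CatalanRemarks, Sect. 2, Theorem 2] -/
def pf0T (n : ℚ) : ℚ :=
  (-7040 * n ^ 6 + 4160 * n ^ 5 + 5984 * n ^ 4 - 3008 * n ^ 3 - 840 * n ^ 2 + 60 * n + 18) / (n * (2 * n - 1))

/-- `ẽ₁(n)`. [cite: Zudilin2002CatalanRemarks, Sect. 2, Theorem 2] -/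
def pf1T (n : ℚ) : ℚ :=
  (-21760 * n ^ 8 + 66560 * n ^ 7 - 40064 * n ^ 6 - 42816 * n ^ 5 + 42848 * n ^ 4 - 2304 * n ^ 3 - 3256 * n ^ 2
    + 36 * n + 63) / (2 * n * (2 * n - 1) ^ 2)

/-- `ẽ₂(n) = σ̃_n(1)`. [cite: Zudilin2002CatalanRemarks, Sect. 2, Theorem 2] -/
def pf2T (n : ℚ) : ℚ :=
  (9280 * n ^ 8 + 3520 * n ^ 7 - 19408 * n ^ 6 + 2672 * n ^ 5 + 10652 * n ^ 4 - 3716 * n ^ 3 - 1191 * n ^ 2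
    + 99 * n + 27) / (2 * n * (2 * n - 1))

/-- `ẽ₃(n) = 16(2n+1)P̃(n,P_{n+1})/(n(2n−1)³)` (residue of `σ̃_n` at its extra pole `P_{n+1}`, rescaled).
[cite: Zudilin2002CatalanRemarks, Sect. 2, Theorem 2] -/
def pf3T (n : ℚ) : ℚ :=
  (5120 * n ^ 7 - 2560 * n ^ 6 - 9472 * n ^ 5 - 896 * n ^ 4 + 4288 * n ^ 3 + 1696 * n ^ 2 - 48 * n - 72)
    / (2 * n - 1) ^ 2

/-- On the poles of `R̃_n` (`k ≤ n`, `n ≥ 1`): `telT n k = resRT n k·σ̃_n(P_k)` with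
`σ̃_n(P_k) = −(n+k)P̃(n,P_k)/(2n(2n−1)(n+1−k))`. [cite: Zudilin2002CatalanRemarks, Sect. 2, Theorem 2] -/
theorem telT_eq_resRT_mul (n : ℕ) (k : ℤ) (hn : 1 ≤ n) (hk : k ≤ n) :
    telT n k = resRT n k * (-(((n : ℚ) + k) * certPT n (pole k)) / (2 * n * (2 * n - 1) * ((n : ℚ) + 1 - k))) := by
  have hne : ((n : ℚ) + 1 - k) ≠ 0 := by
    intro h
    have : ((n : ℤ) + 1 - k) = 0 := by exact_mod_cast h
    omega
  have hn0 : (n : ℚ) ≠ 0 := by positivity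
  have h21 : (2 * (n : ℚ) - 1) ≠ 0 := by
    have : (1 : ℚ) ≤ n := by exact_mod_cast hn
    intro h; linarith
  unfold telT resRT
  rw [invFac_eq_succ_mul ((n : ℤ) - k) ((n : ℤ) + 1 - k) (by ring)]
  push_cast
  field_simp
  ring

/-- **The decomposition of `σ̃_n(P_k)/(1−P_k)²`** along `1, 1/(1−P_k), 1/(1−P_k)², 1/(4P_k−2n−3)` (`k ≤ n`, `n ≥ 1`).
[cite: Zudilin2002CatalanRemarks, Sect. 2, Theorem 2] -/
theorem sigma_decompT (n : ℕ) (k : ℤ) (hn : 1 ≤ n) (hk : k ≤ n) :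
    -(((n : ℚ) + k) * certPT n (pole k)) / (2 * n * (2 * n - 1) * ((n : ℚ) + 1 - k)) / (1 - pole k) ^ 2
      = pf0T n + pf1T n / (1 - pole k) + pf2T n / (1 - pole k) ^ 2 + pf3T n / (4 * pole k - 2 * n - 3) := by
  -- substitute `y = 1 − P_k`: `k = (3 − 4y)/2`, `n + 1 − k = (2n−1+4y)/2`, `4P_k − 2n − 3 = −(2n−1+4y)`
  obtain ⟨y, hy⟩ : ∃ y : ℚ, pole k = 1 - y := ⟨1 - pole k, by ring⟩
  have hk' : (k : ℚ) = (3 - 4 * y) / 2 := by unfold pole at hy; linarith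
  have hy0 : y ≠ 0 := by
    intro h0
    rw [h0] at hk'
    have : (2 * k : ℤ) = 3 := by
      have h' : (2 * (k : ℚ)) = 3 := by rw [hk']; ring
      exact_mod_cast h'
    omega
  have hz : (2 * (n : ℚ) - 1 + 4 * y) ≠ 0 := by
    intro h0
    have h' : ((n : ℚ) + 1 - k) = 0 := by rw [hk']; linarith
    have : ((n : ℤ) + 1 - k) = 0 := by exact_mod_cast h'
    omega
  have hn0 : (n : ℚ) ≠ 0 := by positivity
  have h21 : (2 * (n : ℚ) - 1) ≠ 0 := by
    have : (1 : ℚ) ≤ n := by exact_mod_cast hn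
    intro h; linarith
  obtain ⟨z, hz_eq⟩ : ∃ z : ℚ, 2 * (n : ℚ) - 1 + 4 * y = z := ⟨_, rfl⟩
  have hz0 : z ≠ 0 := hz_eq ▸ hz
  rw [hk', hy, sub_sub_cancel, show (n : ℚ) + 1 - (3 - 4 * y) / 2 = (2 * n - 1 + 4 * y) / 2 by ring,
    show 4 * (1 - y) - 2 * (n : ℚ) - 3 = -(2 * n - 1 + 4 * y) by ring, hz_eq]
  rw [div_neg, show 2 * (n : ℚ) * (2 * n - 1) * (z / 2) = n * (2 * n - 1) * z by ring]
  unfold pf0T pf1T pf2T pf3T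
  obtain ⟨w, hw⟩ : ∃ w : ℚ, 2 * (n : ℚ) - 1 = w := ⟨_, rfl⟩
  have hw0 : w ≠ 0 := hw ▸ h21
  rw [hw]
  field_simp
  subst hw hz_eq
  unfold certPT
  ring

/-! ### `B̃_n = 0` for `n ≥ 2` -/

/-- The four moment sums at once, over the poles `i ≤ 2n` of `R̃_n` (`n ≥ 2`):
`Σ_{i<2n+1} lagT·(a + b/(1−ν_i) + c/(1−ν_i)² + d(ν_i−ν_{2n+1})⁻¹) = −d·w_{2n+1}Ñ_n(ν_{2n+1})` (the `i = 2n+1` summands all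
vanish, so the sums of file 2 over `i < 2n+2` apply). [cite: Zudilin2002CatalanRemarks, Sect. 2, eq. (12)] -/
theorem sum_lagT_moments (n : ℕ) (hn : 2 ≤ n) (a b c d : ℚ) :
    ∑ i ∈ range (2 * n + 1), lagT n i *
        (a + b / (1 - node n i) + c / (1 - node n i) ^ 2 + d * (node n i - node n (2 * n + 1))⁻¹)
      = -(d * (Lagrange.nodalWeight (range (2 * n + 2)) (node n) (2 * n + 1) * (numPT n).eval (node n (2 * n + 1)))) := by
  have ext : ∑ i ∈ range (2 * n + 1), lagT n i *
        (a + b / (1 - node n i) + c / (1 - node n i) ^ 2 + d * (node n i - node n (2 * n + 1))⁻¹)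
      = ∑ i ∈ range (2 * n + 2), lagT n i *
        (a + b / (1 - node n i) + c / (1 - node n i) ^ 2 + d * (node n i - node n (2 * n + 1))⁻¹) := by
    rw [Finset.sum_range_succ (n := 2 * n + 1), lagT_top, zero_mul, add_zero]
  have e : ∀ i ∈ range (2 * n + 2), lagT n i *
        (a + b / (1 - node n i) + c / (1 - node n i) ^ 2 + d * (node n i - node n (2 * n + 1))⁻¹)
      = a * lagT n i + b * (lagT n i / (1 - node n i)) + c * (lagT n i / (1 - node n i) ^ 2)
        + d * (lagT n i * (node n i - node n (2 * n + 1))⁻¹) := by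
    intro i _; ring
  rw [ext, Finset.sum_congr rfl e, Finset.sum_add_distrib, Finset.sum_add_distrib, Finset.sum_add_distrib,
    ← Finset.mul_sum, ← Finset.mul_sum, ← Finset.mul_sum, ← Finset.mul_sum, sum_lagT_eq_zero n (by omega),
    sum_lagT_div_eq_zero n (by omega), sum_lagT_div_sq_eq_zero n hn, sum_lagT_mul_inv_top]
  ring

/-- The extra residue in closed form: `telT n (n+1) = −(2n+1)P̃(n,P_{n+1})/(8(2n−1)) · (−(−1)ⁿ(2n)!/(2n+1)!)·binom·binom`.
[cite: Zudilin2002CatalanRemarks, Sect. 2, Theorem 2] -/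
theorem telT_top (n : ℕ) :
    telT n ((n : ℤ) + 1) = -(((n : ℚ) + ((n : ℚ) + 1)) * certPT n (pole ((n : ℤ) + 1)) / (8 * (2 * (n : ℚ) - 1))) *
      (-(-1) ^ n * ((2 * n).factorial : ℚ) * (((2 * n + 1).factorial : ℚ))⁻¹ * 1
        * gbinom (xq ((n : ℤ) + 1)) (n - 1) * gbinom (xq ((n : ℤ) + 1)) n) := by
  unfold telT
  rw [show (n : ℤ) + ((n : ℤ) + 1) = ((2 * n + 1 : ℕ) : ℤ) by push_cast; ring, invFac_natCast,
    show (n : ℤ) + 1 - ((n : ℤ) + 1) = ((0 : ℕ) : ℤ) by simp, invFac_natCast, zpow_add_one₀ (by norm_num),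
    zpow_natCast]
  push_cast
  simp only [Nat.factorial_zero, Nat.cast_one, inv_one]
  ring

/-- **`B̃_n = 0` for `n ≥ 2`**: the telescoper `S̃_n = σ̃_nR̃_n` inherits the double zero of `R̃_n` at `t = 1`
(`B̃_n = −S̃_n′(1)`), proved by pure partial-fraction algebra: `B̃_n = μ̃_n(ẽ₀M₀ + ẽ₁M₁ + ẽ₂M₂ − ¼ẽ₃w_{2n+1}Ñ_n(ν_{2n+1}))
+ telT n (n+1)·16/(2n−1)²`, the moments vanish and the last two terms cancel in closed form.
[cite: Zudilin2002CatalanRemarks, Sect. 2, Theorem 2] -/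
theorem BsumT_eq_zero (n : ℕ) (hn : 2 ≤ n) : BsumT n = 0 := by
  unfold BsumT wsum
  rw [show 2 * (n + 1) + 1 = (2 * n + 1) + 1 + 1 by ring, Finset.sum_range_succ, Finset.sum_range_succ']
  beta_reduce
  have z1 : telT n (((0 : ℕ) : ℤ) - ((n + 1 : ℕ) : ℤ)) = 0 := telT_eq_zero_of_le _ _ (by push_cast; omega)
  rw [z1, zero_div, add_zero]
  have top : (((2 * n + 1 + 1 : ℕ) : ℤ) - ((n + 1 : ℕ) : ℤ)) = (n : ℤ) + 1 := by omega
  have mid : ∀ i : ℕ, (((i + 1 : ℕ) : ℤ) - ((n + 1 : ℕ) : ℤ)) = (i : ℤ) - n := by intro i; omega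
  simp only [top, mid]
  -- the sum over the poles of `R̃_n`
  have main : ∀ i ∈ range (2 * n + 1), telT n ((i : ℤ) - n) / (1 - pole ((i : ℤ) - n)) ^ 2 =
      lagT n i * (muRT n * pf0T n + muRT n * pf1T n / (1 - node n i) + muRT n * pf2T n / (1 - node n i) ^ 2
        + muRT n * pf3T n / 4 * (node n i - node n (2 * n + 1))⁻¹) := by
    intro i hi
    have hi' := mem_range.mp hi
    rw [telT_eq_resRT_mul n _ (by omega) (by omega), mul_div_assoc, sigma_decompT n _ (by omega) (by omega),
      resRT_eq_muRT_lagT n i (by omega) (by omega), ← node_eq_pole,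
      show 4 * node n i - 2 * n - 3 = 4 * (node n i - node n (2 * n + 1)) by unfold node; push_cast; ring]
    have hne : (node n i - node n (2 * n + 1)) ≠ 0 := node_sub_top_ne_zero n i hi'
    field_simp
  rw [Finset.sum_congr rfl main, sum_lagT_moments n hn, nodalWeight_eq n (2 * n + 1) (by omega), eval_numPT_node,
    show (((2 * n + 1 : ℕ) : ℤ) - n) = (n : ℤ) + 1 by push_cast; ring, telT_top,
    show 1 - pole ((n : ℤ) + 1) = -(2 * (n : ℚ) - 1) / 4 by unfold pole; push_cast; ring,
    show 2 * n + 1 - (2 * n + 1) = 0 from Nat.sub_self _]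
  obtain ⟨m, rfl⟩ : ∃ m, n = m + 1 := ⟨n - 1, by omega⟩
  simp only [Nat.add_sub_cancel]
  have hf1 : ((2 * (m + 1) + 1).factorial : ℚ) = (2 * (m : ℚ) + 3) * ((2 * (m + 1)).factorial : ℚ) := by
    rw [Nat.factorial_succ]; push_cast; ring
  have hf2 : ((m + 1).factorial : ℚ) = ((m : ℚ) + 1) * (m.factorial : ℚ) := by
    rw [Nat.factorial_succ]; push_cast; ring
  rw [hf1, hf2]
  unfold muRT pf3T certPT pole
  simp only [Nat.add_sub_cancel]
  have h1 : ((2 * (m + 1)).factorial : ℚ) ≠ 0 := by positivity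
  have h2 : ((m.factorial : ℚ)) ≠ 0 := by positivity
  have h3 : (2 * (m : ℚ) + 3) ≠ 0 := by positivity
  have h4 : ((m : ℚ) + 1) ≠ 0 := by positivity
  push_cast
  -- make `2(m+1) − 1` an atom for `field_simp`
  obtain ⟨w, hw⟩ : ∃ w : ℚ, 2 * ((m : ℚ) + 1) - 1 = w := ⟨_, rfl⟩
  have hw0 : w ≠ 0 := by
    rw [← hw]
    have : (0 : ℚ) ≤ m := Nat.cast_nonneg m
    intro h; linarith
  rw [hw]
  field_simp
  subst hw
  ring

/-! ### `ṽ_n = Ṽ_n` for `n ≥ 1` -/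

/-- `Ṽ_1 = 5 = ṽ_1` (`κ(−1) = −16`, `κ(0) = κ(1) = 0`). [cite: Zudilin2002CatalanRemarks, Sect. 2, eq. (13)] -/
theorem VresT_one : VresT 1 = 5 := by
  norm_num [VresT, wsum, Finset.sum_range_succ, resRT, invFac, xq, gbinom, kap, kapPos, kapNeg]
  norm_num [show Int.toNat 2 = 2 from rfl, Nat.factorial, kapPos, kapNeg]

/-- `Ṽ_2 = 1897/36 = ṽ_2`. [cite: Zudilin2002CatalanRemarks, Sect. 2, eq. (13)] -/
theorem VresT_two : VresT 2 = 1897 / 36 := by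
  norm_num [VresT, wsum, Finset.sum_range_succ, resRT, invFac, xq, gbinom, kap, kapPos, kapNeg,
    Finset.prod_range_succ]
  norm_num [show Int.toNat 4 = 4 from rfl, show Int.toNat 3 = 3 from rfl, show Int.toNat 2 = 2 from rfl,
    Nat.factorial, kapPos, kapNeg]

/-- The residue sequence patched at `n = 0`: `ṽ_0 = −1` (where `Ṽ_0 = 0`), `Ṽ_n` for `n ≥ 1`.
[cite: Zudilin2002CatalanRemarks, Sect. 2, eq. (13)] -/
def VseqT (n : ℕ) : ℚ := if n = 0 then -1 else VresT n

/-- **`VseqT` solves (13)** (`n = 1`: the values `−1, 5, 1897/36`; `n ≥ 2`: `VresT_rec` and `B̃_n = 0`).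
[cite: Zudilin2002CatalanRemarks, Sect. 2, Theorem 2, eq. (13)] -/
theorem VseqT_isSolutionT : IsSolutionT VseqT := by
  intro n hn
  rcases Nat.lt_or_ge n 2 with h | h
  · obtain rfl : n = 1 := by omega
    simp only [VseqT, show (1 : ℕ) + 1 = 2 from rfl, show (1 : ℕ) - 1 = 0 from rfl, VresT_two, VresT_one]
    norm_num [pT, qT]
  · obtain ⟨m, rfl⟩ : ∃ m, n = m + 2 := ⟨n - 2, by omega⟩
    have e3 : VseqT (m + 2 + 1) = VresT (m + 3) := by simp [VseqT]
    have e2 : VseqT (m + 2) = VresT (m + 2) := by simp [VseqT]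
    have e1 : VseqT (m + 2 - 1) = VresT (m + 1) := by simp [VseqT]
    rw [e3, e2, e1]
    push_cast
    have h := VresT_rec m
    rw [BsumT_eq_zero (m + 2) (by omega)] at h
    linear_combination h

/-- **`ṽ_n = −Σ_k resRT n k·κ(k)` for `n ≥ 1`** (same recursion (13), same initial values `ṽ_0 = −1`, `ṽ_1 = 5`).
[cite: Zudilin2002CatalanRemarks, Sect. 2, Theorem 2, eqs. (12)–(13)] -/
theorem vT_eq_VresT (n : ℕ) (hn : 1 ≤ n) : vT n = VresT n := by
  have h := (solT_isSolutionT (-1) 5).ext_of_init VseqT_isSolutionT (by simp [VseqT]) (by simp [VseqT, VresT_one])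
  have hn' : n ≠ 0 := by omega
  rw [show vT n = solT (-1) 5 n from rfl, congrFun h n]
  simp [VseqT, hn']

end Summit.KontsevichZagierPeriods.Zeta5Search.CatalanRemarksVT
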